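import Mathlib
import HarnessLib
import Summits.NavierStokesRegularity.NavierStokesRegularity.Theses.QuarterJolt

/-!
# Route QuarterJolt — assembly item `Assembly` (stmt-NavierStokesRegularity-26466), BY NAME

`Assembly := EnstrophyQuarterLaw → NoTerminalJolt → JoltFlatCell → NoFlatCellVertex → NavierStokesRegularity` is exactly the
shape of the route's kernel-checked deciding theorem `Theses.QuarterJolt.closes` (pure logic over
`navierStokesRegularity_of_noBlowup` and the ε-regularity contrapositive
`exists_singularPoint_of_classical_of_not_hasSmoothExtensionPast`); this file records it under a Theorems name so the
assembly item closes (candidate attached by refuter ns-regularity-refuter1 g10, landed verbatim in content by seat ns-qj-p1 g0).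

HONEST FRAMING: the two supports `JoltFlatCell` (26464) and `NoFlatCellVertex` (26465) are proved
(`joltFlatCell_proof`, `noFlatCellVertex_proof`); the two cruxes `EnstrophyQuarterLaw` (1574) and `NoTerminalJolt` (26463)
are OPEN — the route is complete modulo these residuals and no statement about Navier–Stokes regularity is proved. [folklore]
-/

-- the summit and its single sub-problem share the name (CONVENTIONS §1), as in every Theorems file
set_option linter.dupNamespace false

namespace Summit.NavierStokesRegularity.NavierStokesRegularity.Theorems

/-- **Item stmt-NavierStokesRegularity-26466** (`QuarterJolt.Assembly`), BY NAME: the four route items imply Clay (A),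
by the route's deciding theorem `Theses.QuarterJolt.closes`. Conditional on the open cruxes; nothing unconditional about NS
regularity is asserted. [folklore] -/
theorem quarterJolt_assembly_proof :
    Summit.NavierStokesRegularity.NavierStokesRegularity.Theses.QuarterJolt.Assembly := by
  unfold Summit.NavierStokesRegularity.NavierStokesRegularity.Theses.QuarterJolt.Assembly
  intro hQ hJ hF hV
  exact Summit.NavierStokesRegularity.NavierStokesRegularity.Theses.QuarterJolt.closes hQ hJ hF hV

end Summit.NavierStokesRegularity.NavierStokesRegularity.Theorems
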